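import Summits.CriticalPhenomena.PercolationContinuityZ3.Theorems.PercNearOneGluingNoHeavyQuantThreePortBoxGZ
import HarnessLib

/-!
# The three-port residual kit, VII: the GZ chain with V-floors (box certificates for a hair REGION)

builds on p205010 (kernel theorem, internal audit signed; external expert review pending)

Support file (`--supports stmt-CriticalPhenomena-4575`), seat `prim-quant-p1` (gen 5); memo `run/shared/lean/prim/quant/P1-SURPLUS.md` §16.
No definitions, no named facts, no sorries; standard axioms.  Pure real algebra.

`ThreePort.gzBoxV_a_false`: the dominant-row Gladkov–Zimin chain of `…QuantThreePortBoxGZ` (`Ubc ≤ ρ I`, `J ≤ Ĵ = k + (1−k)ρ`, endgame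
`gz_endgame`) with the three lower bounds `Va, Vb, Vc ≤ V_v` taken as HYPOTHESES instead of the box-corner values (see `…QuantThreePortBoxDTV`
for why: region tilings `{V_a ≥ v₀}` feed `max(corner, v₀)`).  [cite: GladkovZimin2024, Thm. 4.6]
-/

noncomputable section

namespace Summit.CriticalPhenomena.PercolationContinuityZ3.Theorems

namespace ThreePort

/-! ### The GZ chain on a box with V-floors -/

/-- **GZ box certificate with V-floors, apex `a`.**  As `gzBox_a_false`, but the lower bounds `Va, Vb, Vc ≤ V_v` are PARAMETERS with
hypotheses `hV_a, hV_b, hV_c` (corner bound or region hypothesis); the numeric condition is that of `gzBox_a_false` with `Va, Vb, Vc` in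
place of the corner values. [this work] -/
theorem gzBoxV_a_false (α β γ U0 Uab Uac Ubc U3 la ha lb hb lc hc C3hi C3lo Va Vb Vc : ℝ)
    (a1 : la ≤ α) (a2 : α ≤ ha) (b1 : lb ≤ β) (b2 : β ≤ hb) (c1 : lc ≤ γ) (c2 : γ ≤ hc)
    (hV_a : Va ≤ β + γ - β * γ - α) (hV_b : Vb ≤ α + γ - α * γ - β) (hV_c : Vc ≤ α + β - α * β - γ)
    (h0 : 0 ≤ U0) (hab : 0 ≤ Uab) (hac : 0 ≤ Uac) (hbc : 0 ≤ Ubc) (h3 : 0 ≤ U3)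
    (hsum : Uab + Uac + Ubc + U3 + U0 = 1)
    (ga : U0 * ((1 - α) * β * γ - α * (1 - β) * (1 - γ)) + Ubc * (β + γ - β * γ - α) < 0)
    (gb : U0 * ((1 - β) * α * γ - β * (1 - α) * (1 - γ)) + Uac * (α + γ - α * γ - β) < 0)
    (gc : U0 * ((1 - γ) * α * β - γ * (1 - α) * (1 - β)) + Uab * (α + β - α * β - γ) < 0)
    (hGZa : (U0 + Ubc) * (Uab + Uac + U3) ≤ Uab + Uac + Ubc)
    (hSig : 2 < (α + β + γ) + (α + β - 2 * α * β) * Uab + (α + γ - 2 * α * γ) * Uac + (β + γ - 2 * β * γ) * Ubc +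
      ((1 - α) * (β + γ - β * γ) + (1 - β) * (α + γ - α * γ) + (1 - γ) * (α + β - α * β)) * U3)
    (hnum : 0 ≤ la ∧ 0 ≤ lb ∧ 0 ≤ lc ∧ ha ≤ 1 / 2 ∧ hb ≤ 1 / 2 ∧ hc ≤ 1 / 2 ∧
      0 < (ha * (1 - lb) * (1 - lc) - (1 - ha) * lb * lc) ∧ 0 ≤ (hb * (1 - la) * (1 - lc) - (1 - hb) * la * lc) ∧
      0 ≤ (hc * (1 - la) * (1 - lb) - (1 - hc) * la * lb) ∧
      0 < Va ∧ 0 < Vb ∧ 0 < Vc ∧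
      (1 - la) * (lb + lc - lb * lc) + (1 - lb) * (la + lc - la * lc) + (1 - lc) * (la + lb - la * lb) ≤ C3hi ∧
      (1 - la) * (lb + hc - lb * hc) + (1 - lb) * (la + hc - la * hc) + (1 - hc) * (la + lb - la * lb) ≤ C3hi ∧
      (1 - la) * (hb + lc - hb * lc) + (1 - hb) * (la + lc - la * lc) + (1 - lc) * (la + hb - la * hb) ≤ C3hi ∧
      (1 - la) * (hb + hc - hb * hc) + (1 - hb) * (la + hc - la * hc) + (1 - hc) * (la + hb - la * hb) ≤ C3hi ∧
      (1 - ha) * (lb + lc - lb * lc) + (1 - lb) * (ha + lc - ha * lc) + (1 - lc) * (ha + lb - ha * lb) ≤ C3hi ∧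
      (1 - ha) * (lb + hc - lb * hc) + (1 - lb) * (ha + hc - ha * hc) + (1 - hc) * (ha + lb - ha * lb) ≤ C3hi ∧
      (1 - ha) * (hb + lc - hb * lc) + (1 - hb) * (ha + lc - ha * lc) + (1 - lc) * (ha + hb - ha * hb) ≤ C3hi ∧
      (1 - ha) * (hb + hc - hb * hc) + (1 - hb) * (ha + hc - ha * hc) + (1 - hc) * (ha + hb - ha * hb) ≤ C3hi ∧
      C3lo ≤ (1 - la) * (lb + lc - lb * lc) + (1 - lb) * (la + lc - la * lc) + (1 - lc) * (la + lb - la * lb) ∧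
      C3lo ≤ (1 - la) * (lb + hc - lb * hc) + (1 - lb) * (la + hc - la * hc) + (1 - hc) * (la + lb - la * lb) ∧
      C3lo ≤ (1 - la) * (hb + lc - hb * lc) + (1 - hb) * (la + lc - la * lc) + (1 - lc) * (la + hb - la * hb) ∧
      C3lo ≤ (1 - la) * (hb + hc - hb * hc) + (1 - hb) * (la + hc - la * hc) + (1 - hc) * (la + hb - la * hb) ∧
      C3lo ≤ (1 - ha) * (lb + lc - lb * lc) + (1 - lb) * (ha + lc - ha * lc) + (1 - lc) * (ha + lb - ha * lb) ∧
      C3lo ≤ (1 - ha) * (lb + hc - lb * hc) + (1 - lb) * (ha + hc - ha * hc) + (1 - hc) * (ha + lb - ha * lb) ∧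
      C3lo ≤ (1 - ha) * (hb + lc - hb * lc) + (1 - hb) * (ha + lc - ha * lc) + (1 - lc) * (ha + hb - ha * hb) ∧
      C3lo ≤ (1 - ha) * (hb + hc - hb * hc) + (1 - hb) * (ha + hc - ha * hc) + (1 - hc) * (ha + hb - ha * hb) ∧
      1 / 2 < C3lo ∧
      ((hb * (1 - la) * (1 - lc) - (1 - hb) * la * lc) / Vb + (hc * (1 - la) * (1 - lb) - (1 - hc) * la * lb) / Vc) ≤ 1 ∧
      ha + hb + hc + ((hb + hc - 2 * hb * hc) + C3hi - 1 / 2) * ((ha * (1 - lb) * (1 - lc) - (1 - ha) * lb * lc) / ((ha * (1 - lb) * (1 - lc) - (1 - ha) * lb * lc) + Va)) ≤ 2 ∧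
      ha + hb + hc + ((hb + hc - 2 * hb * hc) + C3hi - 1 / 2) * ((ha * (1 - lb) * (1 - lc) - (1 - ha) * lb * lc) / ((ha * (1 - lb) * (1 - lc) - (1 - ha) * lb * lc) + Va)) * (1 - (((hb * (1 - la) * (1 - lc) - (1 - hb) * la * lc) / Vb + (hc * (1 - la) * (1 - lb) - (1 - hc) * la * lb) / Vc) + (1 - ((hb * (1 - la) * (1 - lc) - (1 - hb) * la * lc) / Vb + (hc * (1 - la) * (1 - lb) - (1 - hc) * la * lb) / Vc)) * ((ha * (1 - lb) * (1 - lc) - (1 - ha) * lb * lc) / ((ha * (1 - lb) * (1 - lc) - (1 - ha) * lb * lc) + Va)))) + C3hi * (((hb * (1 - la) * (1 - lc) - (1 - hb) * la * lc) / Vb + (hc * (1 - la) * (1 - lb) - (1 - hc) * la * lb) / Vc) + (1 - ((hb * (1 - la) * (1 - lc) - (1 - hb) * la * lc) / Vb + (hc * (1 - la) * (1 - lb) - (1 - hc) * la * lb) / Vc)) * ((ha * (1 - lb) * (1 - lc) - (1 - ha) * lb * lc) / ((ha * (1 - lb) * (1 - lc) - (1 - ha) * lb * lc) + Va))) -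
          (C3lo - 1 / 2) * (1 - (((hb * (1 - la) * (1 - lc) - (1 - hb) * la * lc) / Vb + (hc * (1 - la) * (1 - lb) - (1 - hc) * la * lb) / Vc) + (1 - ((hb * (1 - la) * (1 - lc) - (1 - hb) * la * lc) / Vb + (hc * (1 - la) * (1 - lb) - (1 - hc) * la * lb) / Vc)) * ((ha * (1 - lb) * (1 - lc) - (1 - ha) * lb * lc) / ((ha * (1 - lb) * (1 - lc) - (1 - ha) * lb * lc) + Va)))) * (((hb * (1 - la) * (1 - lc) - (1 - hb) * la * lc) / Vb + (hc * (1 - la) * (1 - lb) - (1 - hc) * la * lb) / Vc) + (1 - ((hb * (1 - la) * (1 - lc) - (1 - hb) * la * lc) / Vb + (hc * (1 - la) * (1 - lb) - (1 - hc) * la * lb) / Vc)) * ((ha * (1 - lb) * (1 - lc) - (1 - ha) * lb * lc) / ((ha * (1 - lb) * (1 - lc) - (1 - ha) * lb * lc) + Va))) ≤ 2) : False := by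
  obtain ⟨hla, hlb, hlc, hha, hhb, hhc, hTa0, hTb0, hTc0, hVa0, hVb0, hVc0, v1, v2, v3, v4, v5, v6, v7, v8,
    w1, w2, w3, w4, w5, w6, w7, w8, hC3lo, hk1, hP1, hP2⟩ := hnum
  set Ta : ℝ := ha * (1 - lb) * (1 - lc) - (1 - ha) * lb * lc with hTa
  set Tb : ℝ := hb * (1 - la) * (1 - lc) - (1 - hb) * la * lc with hTb
  set Tc : ℝ := hc * (1 - la) * (1 - lb) - (1 - hc) * la * lb with hTc
  set CPa : ℝ := hb + hc - 2 * hb * hc with hCPa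
  set c3 : ℝ := (1 - α) * (β + γ - β * γ) + (1 - β) * (α + γ - α * γ) + (1 - γ) * (α + β - α * β) with hc3
  have hα1 : α ≤ 1 / 2 := a2.trans hha
  have hβ1 : β ≤ 1 / 2 := b2.trans hhb
  have hγ1 : γ ≤ 1 / 2 := c2.trans hhc
  have hT_a : α * (1 - β) * (1 - γ) - (1 - α) * β * γ ≤ Ta :=
    Tm_le_box α β γ la ha lb hb lc hc a1 a2 b1 b2 c1 c2 hla hlb hlc (by linarith only [hha]) (by linarith only [hhb])
      (by linarith only [hhc])
  have hT_b : β * (1 - α) * (1 - γ) - (1 - β) * α * γ ≤ Tb :=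
    Tm_le_box β α γ lb hb la ha lc hc b1 b2 a1 a2 c1 c2 hlb hla hlc (by linarith only [hhb]) (by linarith only [hha])
      (by linarith only [hhc])
  have hT_c : γ * (1 - α) * (1 - β) - (1 - γ) * α * β ≤ Tc :=
    Tm_le_box γ α β lc hc la ha lb hb c1 c2 a1 a2 b1 b2 hlc hla hlb (by linarith only [hhc]) (by linarith only [hha])
      (by linarith only [hhb])
  have hc3hi : c3 ≤ C3hi := c3_le_of_vertices α β γ la ha lb hb lc hc C3hi a1 a2 b1 b2 c1 c2 v1 v2 v3 v4 v5 v6 v7 v8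
  have hc3lo : C3lo ≤ c3 := c3_ge_of_vertices α β γ la ha lb hb lc hc C3lo a1 a2 b1 b2 c1 c2 w1 w2 w3 w4 w5 w6 w7 w8
  have hca : β + γ - 2 * β * γ ≤ CPa := cpair_le_box β γ hb hc b2 c2 hhb hγ1
  have hcb1 : α + γ - 2 * α * γ ≤ 1 / 2 := by
    have : 0 ≤ (1 - 2 * α) * (1 - 2 * γ) := mul_nonneg (by linarith only [hα1]) (by linarith only [hγ1])
    linarith only [this]
  have hcc1 : α + β - 2 * α * β ≤ 1 / 2 := by
    have : 0 ≤ (1 - 2 * α) * (1 - 2 * β) := mul_nonneg (by linarith only [hα1]) (by linarith only [hβ1])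
    linarith only [this]
  -- caps
  have ga' : Ubc * (β + γ - β * γ - α) < U0 * (α * (1 - β) * (1 - γ) - (1 - α) * β * γ) := by linarith only [ga]
  have gb' : Uac * (α + γ - α * γ - β) < U0 * (β * (1 - α) * (1 - γ) - (1 - β) * α * γ) := by linarith only [gb]
  have gc' : Uab * (α + β - α * β - γ) < U0 * (γ * (1 - α) * (1 - β) - (1 - γ) * α * β) := by linarith only [gc]
  have hU0 : 0 < U0 := by
    by_contra h
    have hz : U0 = 0 := le_antisymm (not_lt.1 h) h0
    have h1 : 0 ≤ Uab * (α + β - α * β - γ) := mul_nonneg hab (by linarith only [hV_c, hVc0])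
    rw [hz, zero_mul] at gc'
    exact absurd gc' (not_lt.2 h1)
  set κb : ℝ := Tb / Vb with hκb
  set κc : ℝ := Tc / Vc with hκc
  set ρ : ℝ := Ta / (Ta + Va) with hρ
  have hρ0 : 0 ≤ ρ := div_nonneg hTa0.le (by linarith only [hTa0, hVa0])
  have hUac : Uac ≤ κb * U0 := by
    have h1 : Vb * Uac ≤ Uac * (α + γ - α * γ - β) := by rw [mul_comm]; exact mul_le_mul_of_nonneg_left hV_b hac
    have h2 : U0 * (β * (1 - α) * (1 - γ) - (1 - β) * α * γ) ≤ U0 * Tb := mul_le_mul_of_nonneg_left hT_b h0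
    have h3' : Uac * Vb ≤ Tb * U0 := by linarith only [h1, h2, gb']
    rw [hκb, div_mul_eq_mul_div, le_div_iff₀ hVb0]; exact h3'
  have hUab : Uab ≤ κc * U0 := by
    have h1 : Vc * Uab ≤ Uab * (α + β - α * β - γ) := by rw [mul_comm]; exact mul_le_mul_of_nonneg_left hV_c hab
    have h2 : U0 * (γ * (1 - α) * (1 - β) - (1 - γ) * α * β) ≤ U0 * Tc := mul_le_mul_of_nonneg_left hT_c h0
    have h3' : Uab * Vc ≤ Tc * U0 := by linarith only [h1, h2, gc']
    rw [hκc, div_mul_eq_mul_div, le_div_iff₀ hVc0]; exact h3'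
  -- `I = U0 + Ubc`, `J = Uab + Uac + U3`; `Ubc ≤ ρ I`
  set I : ℝ := U0 + Ubc with hI
  set J : ℝ := Uab + Uac + U3 with hJ
  have hIJ : I + J = 1 := by rw [hI, hJ]; linarith only [hsum]
  have hI0 : 0 < I := by rw [hI]; linarith only [hU0, hbc]
  have hJ0 : 0 ≤ J := by rw [hJ]; linarith only [hab, hac, h3]
  have hUbc : Ubc ≤ ρ * I := by
    have h1 : Va * Ubc ≤ Ubc * (β + γ - β * γ - α) := by rw [mul_comm]; exact mul_le_mul_of_nonneg_left hV_a hbc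
    have h2 : U0 * (α * (1 - β) * (1 - γ) - (1 - α) * β * γ) ≤ U0 * Ta := mul_le_mul_of_nonneg_left hT_a h0
    have h3' : Ubc * (Ta + Va) ≤ Ta * I := by rw [hI]; linarith only [h1, h2, ga']
    rw [hρ, div_mul_eq_mul_div, le_div_iff₀ (by linarith only [hTa0, hVa0] : (0:ℝ) < Ta + Va)]; exact h3'
  -- GZ at apex `a` bounds `J`
  set Jm : ℝ := (κb + κc) + (1 - (κb + κc)) * ρ with hJm
  have hJle : J ≤ Jm := by
    have h1 : Uab + Uac + Ubc ≤ (κb + κc) * I + (1 - (κb + κc)) * Ubc := by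
      rw [hI]; linarith only [hUab, hUac]
    have h2 : (1 - (κb + κc)) * Ubc ≤ (1 - (κb + κc)) * (ρ * I) := mul_le_mul_of_nonneg_left hUbc (by linarith only [hk1])
    have h3' : I * J ≤ I * Jm := by rw [hJm]; linarith only [hGZa, h1, h2]
    exact le_of_mul_le_mul_left h3' hI0
  -- `Σ > 2` and `(c₃ − ½)·GZ`
  have hS1 : 2 < ha + hb + hc + (CPa + C3hi - 1 / 2) * Ubc + C3hi * J - (C3lo - 1 / 2) * (I * J) := by
    have hU3 : U3 = J - Uab - Uac := by rw [hJ]; ring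
    have e1 : c3 * U3 = c3 * J - c3 * Uab - c3 * Uac := by rw [hU3]; ring
    have hGZ' : (c3 - 1 / 2) * (I * J) ≤ (c3 - 1 / 2) * (Uab + Uac + Ubc) :=
      mul_le_mul_of_nonneg_left hGZa (by linarith only [hc3lo, hC3lo])
    have e2 : (c3 - 1 / 2) * (Uab + Uac + Ubc) = c3 * Uab + c3 * Uac + c3 * Ubc - 1 / 2 * Uab - 1 / 2 * Uac - 1 / 2 * Ubc := by
      ring
    have t1 : (β + γ - 2 * β * γ + (c3 - 1 / 2)) * Ubc ≤ (CPa + C3hi - 1 / 2) * Ubc :=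
      mul_le_mul_of_nonneg_right (by linarith only [hca, hc3hi]) hbc
    have e3 : (β + γ - 2 * β * γ + (c3 - 1 / 2)) * Ubc = (β + γ - 2 * β * γ) * Ubc + c3 * Ubc - 1 / 2 * Ubc := by ring
    have t2 : (α + γ - 2 * α * γ) * Uac ≤ 1 / 2 * Uac := mul_le_mul_of_nonneg_right hcb1 hac
    have t3 : (α + β - 2 * α * β) * Uab ≤ 1 / 2 * Uab := mul_le_mul_of_nonneg_right hcc1 hab
    have t4 : c3 * J ≤ C3hi * J := mul_le_mul_of_nonneg_right hc3hi hJ0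
    have t5 : (C3lo - 1 / 2) * (I * J) ≤ (c3 - 1 / 2) * (I * J) :=
      mul_le_mul_of_nonneg_right (by linarith only [hc3lo]) (mul_nonneg hI0.le hJ0)
    linarith only [hSig, e1, hGZ', e2, t1, e3, t2, t3, t4, t5, a2, b2, c2]
  -- convexity step and the two endpoint conditions
  have hA0 : 0 ≤ CPa + C3hi - 1 / 2 := by
    have h1 : 0 ≤ hb := hlb.trans (b1.trans b2)
    have h2 : 0 ≤ hc := hlc.trans (c1.trans c2)
    have : 0 ≤ hb * (1 - 2 * hc) := mul_nonneg h1 (by linarith only [hhc])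
    have hCPa0 : 0 ≤ CPa := by rw [hCPa]; linarith only [this, h2]
    linarith only [hCPa0, hc3lo, hc3hi, hC3lo]
  have hIJ' : (1 - Jm) * J ≤ I * J := by
    have h1 : 0 ≤ (Jm - J) * J := mul_nonneg (by linarith only [hJle]) hJ0
    have eI : I = 1 - J := by linarith only [hIJ]
    rw [eI]; linarith only [h1]
  have hS2 : 2 < ha + hb + hc + (CPa + C3hi - 1 / 2) * ρ +
      (C3hi - (CPa + C3hi - 1 / 2) * ρ - (C3lo - 1 / 2) * (1 - Jm)) * J := by
    have h1 : (CPa + C3hi - 1 / 2) * Ubc ≤ (CPa + C3hi - 1 / 2) * (ρ * I) := mul_le_mul_of_nonneg_left hUbc hA0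
    have h2 : (C3lo - 1 / 2) * ((1 - Jm) * J) ≤ (C3lo - 1 / 2) * (I * J) :=
      mul_le_mul_of_nonneg_left hIJ' (by linarith only [hC3lo])
    have eI : I = 1 - J := by linarith only [hIJ]
    rw [eI] at h1
    linarith only [hS1, h1, h2]
  exact gz_endgame (ha + hb + hc) (CPa + C3hi - 1 / 2) ρ Jm J C3hi (C3lo - 1 / 2) hJ0 hJle hS2 hP1 hP2

end ThreePort

end Summit.CriticalPhenomena.PercolationContinuityZ3.Theorems

end
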